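import Mathlib.Analysis.SpecialFunctions.Gaussian.FourierTransform
import Mathlib.MeasureTheory.Constructions.HaarToSphere
import Mathlib.MeasureTheory.Measure.Haar.InnerProductSpace
import Mathlib.MeasureTheory.Integral.Gamma
import HarnessLib

/-!
# Radial Gaussian moments on a finite-dimensional inner product space

Analysis/SpecialFunctions support file (everything proved, no definitions, no named facts).
For a finite-dimensional real inner product space `V` of dimension `d ≥ 1` with its canonical
Lebesgue measure and `b > 0`:

* `integral_norm_pow_mul_exp_neg_mul_sq_norm` —
  `∫ ‖v‖^k e^{-b‖v‖²} dv = d · vol(B₁) · (b^{-(k+d)/2} · ½ · Γ((k+d)/2))` for every `k : ℕ`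
  (polar coordinates `MeasureTheory.integral_fun_norm_addHaar` + the Gamma integral
  `integral_rpow_mul_exp_neg_mul_rpow`);
* `integral_norm_sq_mul_exp_neg_mul_sq_norm` — **the second moment in closed form**
  `∫ ‖v‖² e^{-b‖v‖²} dv = (d / (2b)) · (π / b)^{d/2}` (the case `k = 2` divided by the case `k = 0`,
  `Γ(d/2 + 1) = (d/2) Γ(d/2)`, and Mathlib's `GaussianFourier.integral_rexp_neg_mul_sq_norm`
  `∫ e^{-b‖v‖²} = (π/b)^{d/2}`);
* `integral_norm_sq_mul_exp_neg_mul_sq_norm_three` — on `ℝ³ = EuclideanSpace ℝ (Fin 3)`: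
  `∫ ‖ξ‖² e^{-b‖ξ‖²} dξ = (3 / (2b)) · (π / b)^{3/2}`;
* `integral_norm_sq_mul_exp_neg_heat_three` — the **Fourier-side heat-kernel gradient constant**:
  for `ν, t > 0`, `∫_{ℝ³} ‖ξ‖² e^{-2νt‖ξ‖²} dξ = (3 π^{3/2} / 2^{7/2}) · (ν t)^{-5/2}`, i.e.
  `‖ |ξ| e^{-νt|ξ|²} ‖_{L²(ℝ³)} = c · (νt)^{-5/4}` — the source of the exponent `-5/4` in
  Fourier-variable treatments of the Duhamel term of the Navier–Stokes equations
  (e.g. the integral-inequality argument of A. G. Ramm, Modern Math. Methods 2 (2024) 19–26,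
  (1.17) p. 21 and (1.26) p. 23, adjudicated by cell ns-claims as claim C04 `Ramm2024`; the
  identity itself is an elementary Gaussian moment and is recorded here as folklore).

## Mathlib / tree search

Mathlib: `GaussianFourier.integral_rexp_neg_mul_sq_norm` (mass), `integral_fun_norm_addHaar`
(polar coordinates for any norm), `integral_rpow_mul_exp_neg_mul_rpow`,
`integral_rpow_mul_exp_neg_mul_sq` (half-line moments), `Real.Gamma_add_one`; no second-moment
identity on a `d`-dimensional space (searched `norm_sq_mul_exp_neg`, `moment.*gaussian`). Tree:
the same polar-coordinate computation exists Summits-side only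
(`Summit.Ventures.LatticeQCDFlow.Exactness.integral_norm_sq_mul_exp_neg_mul_sq_norm_addHaar`,
not importable into `Literature/`); `Literature/Algebra/EuclideanLattices/SmoothingGaussianMoments.lean`
has discrete (lattice-sum) moments only. The statements below are the `volume` specialisation
with the mass evaluated in closed form.

WHAT THIS IS NOT: not a claim about NS regularity or blow-up; not a claim about any author beyond the typed locator.
-/

noncomputable section

open Set MeasureTheory Metric Real

namespace Literature.Analysis.SpecialFunctions

section General

variable {V : Type*} [NormedAddCommGroup V] [InnerProductSpace ℝ V] [FiniteDimensional ℝ V]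
  [MeasurableSpace V] [BorelSpace V] [Nontrivial V]

/-- **Radial Gaussian moments by polar coordinates**:
`∫ ‖v‖^k e^{-b‖v‖²} dv = d · vol(B₁) · (b^{-(k+d)/2} · ½ · Γ((k+d)/2))`, `d = dim V ≥ 1`, `b > 0`
(radial reduction GR 4.642 and the half-line moment GR 3.326.2 `∫₀^∞ x^m e^{-βx²} dx = Γ(γ)/(2β^γ)`,
`γ = (m+1)/2`). [cite: GradshteynRyzhik2015, 4.642 and 3.326.2] -/
theorem integral_norm_pow_mul_exp_neg_mul_sq_norm {b : ℝ} (hb : 0 < b) (k : ℕ) :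
    ∫ v : V, ‖v‖ ^ k * exp (-b * ‖v‖ ^ 2) =
      Module.finrank ℝ V * (volume : Measure V).real (ball 0 1) *
        (b ^ (-((k : ℝ) + Module.finrank ℝ V) / 2) * (1 / 2) *
          Gamma (((k : ℝ) + Module.finrank ℝ V) / 2)) := by
  have hd : 1 ≤ Module.finrank ℝ V := Module.finrank_pos
  have hd1 : (((Module.finrank ℝ V - 1 : ℕ) : ℝ)) = (Module.finrank ℝ V : ℝ) - 1 := by
    rw [Nat.cast_sub hd, Nat.cast_one]
  have h := integral_fun_norm_addHaar (volume : Measure V)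
    (fun y : ℝ => y ^ k * exp (-b * y ^ 2))
  rw [h, nsmul_eq_mul, smul_eq_mul]
  have hI : ∫ y in Ioi (0 : ℝ), y ^ (Module.finrank ℝ V - 1) • (y ^ k * exp (-b * y ^ 2)) =
      b ^ (-((k : ℝ) + Module.finrank ℝ V) / 2) * (1 / 2) *
        Gamma (((k : ℝ) + Module.finrank ℝ V) / 2) := by
    have hq : (-1 : ℝ) < (k : ℝ) + Module.finrank ℝ V - 1 := by
      have h1 : (0 : ℝ) ≤ k := Nat.cast_nonneg k
      have h2 : (1 : ℝ) ≤ Module.finrank ℝ V := by exact_mod_cast hd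
      linarith
    have hG := integral_rpow_mul_exp_neg_mul_rpow (p := 2) (q := (k : ℝ) + Module.finrank ℝ V - 1)
      two_pos hq hb
    have e1 : (k : ℝ) + Module.finrank ℝ V - 1 + 1 = (k : ℝ) + Module.finrank ℝ V := by ring
    rw [e1] at hG
    rw [← hG]
    refine setIntegral_congr_fun measurableSet_Ioi fun y hy => ?_
    have hy' : (0 : ℝ) ≤ y := le_of_lt hy
    simp only [smul_eq_mul]
    rw [show ((k : ℝ) + Module.finrank ℝ V - 1) = ((k + (Module.finrank ℝ V - 1) : ℕ) : ℝ) by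
        push_cast [hd1]; ring,
      rpow_natCast, show (2 : ℝ) = ((2 : ℕ) : ℝ) by norm_num, rpow_natCast]
    ring
  rw [hI]
  ring

/-- **Second radial Gaussian moment in closed form**:
`∫ ‖v‖² e^{-b‖v‖²} dv = (d / (2b)) · (π / b)^{d/2}` on a `d`-dimensional real inner product space,
`b > 0` (ratio of the moments `k = 2` and `k = 0`, `Γ(d/2 + 1) = (d/2)Γ(d/2)`, and the Gaussian
mass `∫ e^{-b‖v‖²} = (π/b)^{d/2}`). [cite: GradshteynRyzhik2015, 3.326.2 (m = d+1, n = 2) with 4.642] -/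
theorem integral_norm_sq_mul_exp_neg_mul_sq_norm {b : ℝ} (hb : 0 < b) :
    ∫ v : V, ‖v‖ ^ 2 * exp (-b * ‖v‖ ^ 2) =
      Module.finrank ℝ V / (2 * b) * (π / b) ^ ((Module.finrank ℝ V : ℝ) / 2) := by
  have h0 := integral_norm_pow_mul_exp_neg_mul_sq_norm (V := V) hb 0
  simp only [pow_zero, one_mul, Nat.cast_zero, zero_add] at h0
  have hmass : ∫ v : V, exp (-b * ‖v‖ ^ 2) = (π / b) ^ ((Module.finrank ℝ V : ℝ) / 2) :=
    GaussianFourier.integral_rexp_neg_mul_sq_norm hb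
  have h2 := integral_norm_pow_mul_exp_neg_mul_sq_norm (V := V) hb 2
  rw [h2, ← hmass, h0]
  have hd : (0 : ℝ) < Module.finrank ℝ V := by
    exact_mod_cast (Module.finrank_pos : 0 < Module.finrank ℝ V)
  have h5 : Gamma ((((2 : ℕ) : ℝ) + Module.finrank ℝ V) / 2) =
      Module.finrank ℝ V / 2 * Gamma ((Module.finrank ℝ V : ℝ) / 2) := by
    rw [show (((2 : ℕ) : ℝ) + Module.finrank ℝ V) / 2 = (Module.finrank ℝ V : ℝ) / 2 + 1 by
      push_cast; ring]
    exact Gamma_add_one (by positivity)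
  have hk : b ^ (-(((2 : ℕ) : ℝ) + Module.finrank ℝ V) / 2) =
      b ^ (-(Module.finrank ℝ V : ℝ) / 2) * b⁻¹ := by
    rw [show (-(((2 : ℕ) : ℝ) + Module.finrank ℝ V) / 2) = (-(Module.finrank ℝ V : ℝ) / 2) + (-1) by
      push_cast; ring, rpow_add hb, rpow_neg_one]
  rw [h5, hk]
  field_simp

/-- The integrand `‖v‖^k e^{-b‖v‖²}` is integrable (polar coordinates, GR 4.642, and the convergent
half-line moment GR 3.326.2). [cite: GradshteynRyzhik2015, 4.642 and 3.326.2] -/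
theorem integrable_norm_pow_mul_exp_neg_mul_sq_norm {b : ℝ} (hb : 0 < b) (k : ℕ) :
    Integrable (fun v : V => ‖v‖ ^ k * exp (-b * ‖v‖ ^ 2)) := by
  have hd : 1 ≤ Module.finrank ℝ V := Module.finrank_pos
  have hd1 : (((Module.finrank ℝ V - 1 : ℕ) : ℝ)) = (Module.finrank ℝ V : ℝ) - 1 := by
    rw [Nat.cast_sub hd, Nat.cast_one]
  refine (integrable_fun_norm_addHaar (volume : Measure V)
    (f := fun y : ℝ => y ^ k * exp (-b * y ^ 2))).2 ?_
  have hq : (-1 : ℝ) < (k : ℝ) + Module.finrank ℝ V - 1 := by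
    have h1 : (0 : ℝ) ≤ k := Nat.cast_nonneg k
    have h2 : (1 : ℝ) ≤ Module.finrank ℝ V := by exact_mod_cast hd
    linarith
  have hI := integrableOn_rpow_mul_exp_neg_mul_sq hb (s := (k : ℝ) + Module.finrank ℝ V - 1) hq
  refine (integrableOn_congr_fun (fun y hy => ?_) measurableSet_Ioi).1 hI
  have hy' : (0 : ℝ) ≤ y := le_of_lt hy
  simp only [smul_eq_mul]
  rw [show ((k : ℝ) + Module.finrank ℝ V - 1) = ((k + (Module.finrank ℝ V - 1) : ℕ) : ℝ) by
      push_cast [hd1]; ring, rpow_natCast]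
  ring

end General

section Three

/-- On `ℝ³`: `∫ ‖ξ‖² e^{-b‖ξ‖²} dξ = (3 / (2b)) · (π / b)^{3/2}`, `b > 0` (GR 4.642 with `n = 3` and
GR 3.326.2 with `m = 4`: `4π · Γ(5/2)/(2 b^{5/2}) = (3/(2b))(π/b)^{3/2}`).
[cite: GradshteynRyzhik2015, 3.326.2 and 4.642 (n = 3)] -/
theorem integral_norm_sq_mul_exp_neg_mul_sq_norm_three {b : ℝ} (hb : 0 < b) :
    ∫ ξ : EuclideanSpace ℝ (Fin 3), ‖ξ‖ ^ 2 * exp (-b * ‖ξ‖ ^ 2) =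
      3 / (2 * b) * (π / b) ^ ((3 : ℝ) / 2) := by
  have h := integral_norm_sq_mul_exp_neg_mul_sq_norm (V := EuclideanSpace ℝ (Fin 3)) hb
  rw [finrank_euclideanSpace, Fintype.card_fin] at h
  rw [h]
  norm_num

/-- **The heat-kernel gradient constant in Fourier variables on `ℝ³`**: for `ν, t > 0`,
`∫_{ℝ³} ‖ξ‖² e^{-2νt‖ξ‖²} dξ = (3 π^{3/2} / 2^{7/2}) · (νt)^{-5/2}`; its square root is
`‖ |ξ| e^{-νt|ξ|²} ‖_{L²(ℝ³)} = c (νt)^{-5/4}` — the constant of A. G. Ramm, MMM 2 (2024), (1.17)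
p. 21 / (1.26) p. 23 (claim C04 `Ramm2024` of cell ns-claims; the identity itself is the elementary
Gaussian moment GR 3.326.2/4.642, which is what is cited). [cite: GradshteynRyzhik2015, 3.326.2 and 4.642 (n = 3)] -/
theorem integral_norm_sq_mul_exp_neg_heat_three {ν t : ℝ} (hν : 0 < ν) (ht : 0 < t) :
    ∫ ξ : EuclideanSpace ℝ (Fin 3), ‖ξ‖ ^ 2 * exp (-(2 * ν * t) * ‖ξ‖ ^ 2) =
      3 * π ^ ((3 : ℝ) / 2) / (2 : ℝ) ^ ((7 : ℝ) / 2) * (ν * t) ^ (-(5 : ℝ) / 2) := by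
  have hb : 0 < 2 * ν * t := by positivity
  rw [integral_norm_sq_mul_exp_neg_mul_sq_norm_three hb]
  have hνt : 0 < ν * t := mul_pos hν ht
  rw [div_rpow pi_pos.le hb.le, show (2 * ν * t : ℝ) = 2 * (ν * t) by ring,
    mul_rpow zero_le_two hνt.le]
  have h2 : (2 : ℝ) ^ ((7 : ℝ) / 2) = 4 * (2 : ℝ) ^ ((3 : ℝ) / 2) := by
    rw [show (7 : ℝ) / 2 = 2 + 3 / 2 by norm_num, rpow_add two_pos,
      show (2 : ℝ) ^ (2 : ℝ) = 4 by norm_num]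
  have h3 : (ν * t) ^ (-(5 : ℝ) / 2) = ((ν * t) * (ν * t) ^ ((3 : ℝ) / 2))⁻¹ := by
    rw [show -(5 : ℝ) / 2 = -(1 + 3 / 2) by norm_num, rpow_neg hνt.le, rpow_add hνt, rpow_one]
  rw [h2, h3]
  have hA : 0 < (2 : ℝ) ^ ((3 : ℝ) / 2) := rpow_pos_of_pos two_pos _
  have hB : 0 < (ν * t) ^ ((3 : ℝ) / 2) := rpow_pos_of_pos hνt _
  field_simp
  ring

end Three

end Literature.Analysis.SpecialFunctions

end
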